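import Summits.ResolutionOfSingularities.ResolutionOfSingularities.Theorems.FrobeniusClosingPatchingRelPerfectDepthPhaseCX3Defs
import HarnessLib

/-!
# Crux `PatchingRelPerfect` (stmt-ResolutionOfSingularities-16161), chain W5.2 — F7(β) (β-AX) X3 C-I: THE X3 DEFINITIONS OF RECORD, PIECES
# SIBLING — the contact form ALONG A CLOSED PIECE and the contact cure PER PIECE ((β′) architecture, RULING G12-49 (1))

[OURS · L1 W5.2 · res-L1-w52-plan-1 RULING G12-49 (1) «idea-1 writes it into Sketch v22 (§4.4′), lead-1 files it as a SIBLING defs file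
`…DepthPhaseCX3DefsPieces.lean` (never amend p569657)»; design res-L1-w52-idea-1 Sketch v23 ef7a975cc9d1f939 §4.4b (tri-2 FIRST-STEP NO OBJECTION
21:14:40Z, tri-1 NO OBJECTION 21:15:49Z).]  STATEMENTS ONLY; nothing here is a statement of the manuscript under review; AI-written, AI review weaker
than expert review; counted 0.  Every `def … : Prop` below is one of OUR design targets feeding the pieces bridge
`X3LemmaM.goodEnd_of_closedPieces` (…DepthPhaseCOnePieces) and through it the `hCure` hypothesis of `ChainW52F7BetaRP.phaseCOne_cylReach_of_stages`
(…DepthPhaseCOneAssembly) — not a published fact.  Copied VERBATIM from Sketch v23 §4.4b (both typings, as the design owner posted them):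

* uniform carrier: `HasContactFormOn S P`, `ContactCure₃`, `ContactCureReduction₃` (+ shape `ContactFormOn_singleton_shape`);
* pointwise carrier (RECOMMENDED by the design owner; F-60 called once per piece in the 4-fold): `HasContactFormOnPw S P`, `ContactCure₃Pw`,
  `ContactCureReduction₃Pw` (+ shape `ContactFormOn_uniform_to_pointwise_shape`).

The cures conclude with a `CentreSeq` on an OPEN `U ⊇ P` of `X`; the bridge `goodEnd_of_closedPieces` asks the cure on an arbitrary Noetherian `Y`
open-immersed in `X` — the adapter (restriction along `Scheme.Hom.isoOpensRange`) is lead-1΄s, in the bridge΄s consumer file.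

## References
* V. Cossart, U. Jannsen, S. Saito, arXiv:0905.2191v2 (2020), Thm. 1.4 (embedded resolution with boundary). [CossartJannsenSaito2020]
* J. Kollár, *Lectures on Resolution of Singularities* (2007), (3.111) Step 3. [Kollar2007]
-/

-- `Summit.<Summit>.<Sub>.Theorems` with `Sub = Summit` (single-conjunct summit, D-0017)
set_option linter.dupNamespace false

noncomputable section

namespace Summit.ResolutionOfSingularities.ResolutionOfSingularities.Theorems.X3LemmaM

open CategoryTheory AlgebraicGeometry TopologicalSpace IsLocalRing
open Literature.AlgebraicGeometry.Resolution
open Scheme.IdealSheafData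
open Summit.ResolutionOfSingularities.ResolutionOfSingularities.Theorems.DepthMultiHost

universe u

variable {X : Scheme.{u}}

/-! ## §1 (M2b) along a PIECE — `HasContactFormOn S P`, `ContactCure₃` (G12-47 FACE 1; lead-1 (β′) «disjoint closed pieces + sequential
extension» 20:53:14Z; tri-1 carrier-uniformity test 20:53:53Z; tri-2 (β″) «the contact surface is global per carrier» 20:53:53Z)

lead-1: `hCure` stays GLOBAL; the non-END locus `N ⊆ cosupp K♭` (w.r.t. the global letter list members ++ hosts ++ exceptional components) is
closed, hence a finite disjoint union of closed connected PIECES `P`; a cure is owed PER PIECE on any open `U ⊇ P` with centres OVER `P` (then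
closed in `X`, so `CentreSeqExtend.exists_centreSeq_of_open` globalises).  The per-POINT `ContactCure₂` cannot feed that (tri-2 (1): on AH3e
`Sing 𝒳 ⊇` a curve `Γ` transversal to `E₃` through the pole — every embedded resolution of `𝒳` has a centre dominating `Γ`, which leaves every
small patch).  The Prop below is rev 3 spread along `P`, with three amendments (my 21:07:50Z (4)):
(α) CARRIER = an ideal sheaf `V` with, at every `x ∈ P`, a principal stalk generated by an order-1 germ — no global section (the regularity of
    `G := V.subscheme` near `P` is all F-60 needs); tri-1's test becomes «one host / member ideal sheaf has order 1 along the whole piece»; a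
    carrier SWITCH inside a connected piece is NOT expressible here (residual K22: desk to rule between (β′) and tri-2's (β″), under which this
    Prop is the local CHECK of one global F-60 call per carrier);
(β) ENTRIES = ideal sheaves `Φ_c` (tri-2 (β″): the other hosts' transforms stripped of member factors — global ideal sheaves), the pure entry is
    `(𝓟, ⊤)`; exponent lists range over the members MEETING `P` (a member not through `x` has unit stalk at `x`, so ONE list serves every
    `x ∈ P`); `𝒳 := Supp V ∩ (⋃_c Supp Φ_c) ∩ U` — no sections, no `zeroLocus`; NF0 `Φ_{c,x} ⊄ V_x`, NF1 `Φ_{c,x} ⊄ V_x + T_x` and the stalk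
    equation `K♭_x = V_x + Σ_c 𝓜_{c,x}·Φ_{c,x}` at EVERY `x ∈ P`;
(γ) LEG's target is `y ∈ P` (lead-1: F-60's centres lie over `Sing 𝒳 ∪ (𝒳 ∩ B) ⊆ P`, hence over `P`, hence closed in `X`).
Members meeting `U` but not `P` are removed by shrinking `U` (`P`, members closed), so the boundary clause lists the members meeting `P`. -/

open Classical in
/-- [OURS · L1 W5.2] **CONTACT FORM along a piece `P`** (rev 3 spread out; amendments (α)(β)(γ) above).  NOT a statement of the manuscript. -/
def HasContactFormOn (S : MultiHostState X) (P : Set X) : Prop :=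
  ∃ (U : X.Opens) (_ : P ⊆ (U : Set X)) (V : X.IdealSheafData)
    (𝓒 : List (List (X.IdealSheafData × ℕ) × X.IdealSheafData)) (𝓟 : List (X.IdealSheafData × ℕ)),
    -- (α) carrier: pointwise order-1 principal stalks along `P`
    (∀ x ∈ P, ∃ v : X.presheaf.stalk x,
      v ∉ (maximalIdeal (X.presheaf.stalk x)) ^ 2 ∧ stalkIdeal V x = Ideal.span {v}) ∧
    -- (β) entries: monomials on members meeting `P`; the pure entry `(𝓟, ⊤)`; legality of the pure entry at every `x ∈ P`
    (∀ c ∈ 𝓒, ∀ p ∈ c.1, p.1 ∈ S.𝓔 ∧ ((p.1.support : Set X) ∩ P).Nonempty) ∧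
    (𝓟, (⊤ : X.IdealSheafData)) ∈ 𝓒 ∧
    (∀ x ∈ P, ∀ T ∈ S.𝓔, x ∈ (T.support : Set X) → stalkIdeal (monomialIdeal 𝓟) x ≤ stalkIdeal T x) ∧
    -- boundary: carrier :: members meeting `P`, snc on `U`
    HasSNC ((V :: S.𝓔.filter fun T => decide (((T.support : Set X) ∩ P).Nonempty)).map fun F => F.comap U.ι) ∧
    -- NF0 / NF1 at every `x ∈ P`, for the entries vanishing at `x`
    (∀ x ∈ P, ∀ c ∈ 𝓒, x ∈ (c.2.support : Set X) →
      ¬ stalkIdeal c.2 x ≤ stalkIdeal V x ∧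
      ∀ T ∈ S.𝓔, x ∈ (T.support : Set X) → ¬ stalkIdeal c.2 x ≤ stalkIdeal V x ⊔ stalkIdeal T x) ∧
    -- (γ) LEG: on `U`, Sing 𝒳 ∪ (𝒳 ∩ B) ⊆ P
    (let 𝒳 : Set X := (V.support : Set X) ∩ (⋃ c ∈ 𝓒, (c.2.support : Set X)) ∩ (U : Set X)
     let 𝒵 : X.IdealSheafData := Scheme.IdealSheafData.vanishingIdeal ⟨closure 𝒳, isClosed_closure⟩
     let Sing : Set X := 𝒵.subschemeι.base '' (Scheme.regularLocus 𝒵.subscheme)ᶜ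
     let B : Set X := ⋃ T ∈ S.𝓔, (T.support : Set X)
     ∀ y ∈ (U : Set X), (y ∈ Sing ∨ (y ∈ 𝒳 ∧ y ∈ B)) → y ∈ P) ∧
    -- the stalk equation at every `x ∈ P`
    (∀ x ∈ P, stalkIdeal S.residual.K x = stalkIdeal V x ⊔ ⨆ c ∈ 𝓒, stalkIdeal (monomialIdeal c.1) x * stalkIdeal c.2 x)

/-- Sanity (shape only, OURS): a contact form along `{x}` is the pointwise notion with ideal-sheaf entries; recorded as a Prop, not proved
(rev 3's entries are sections, so the comparison needs `Scheme.IdealSheafData.ofIdeals`-type packaging — typer's business). -/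
def ContactFormOn_singleton_shape : Prop :=
  ∀ (X : Scheme.{u}) (S : MultiHostState X) (x : X), HasContactFormAt S x → HasContactFormOn S {x}

/-- [OURS · L1 W5.2] **(M2b) CONTACT CURE PER PIECE** = lead-1's (C3) 20:53:14Z verbatim over `HasContactFormOn` (K21 kept): for a closed piece
`P ⊆ cosupp K♭` in contact form and ANY open `U ⊇ P`, blowings up of `U` at regular centres OVER `P` (hence closed in `X`), regular top, after
which the total transform of `K♭|_U` has local END at every point of its cosupport lying over `P` (END off `P` is the bridge's transport,
lead-1 (B) `goodEnd_of_closedPieces`).  Proof route: (T-e) `exists_contactTower` on `U` + F-60 (repro-3). -/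
def ContactCure₃ : Prop :=
  ∀ (X : Scheme.{u}) [IsNoetherian X], Scheme.IsRegular X → Scheme.IsExcellent X → topologicalKrullDim X ≤ 4 →
    ∀ (S : MultiHostState X) (P : TopologicalSpace.Closeds X), (P : Set X) ⊆ (S.residual.K.support : Set X) →
      HasContactFormOn S (P : Set X) →
      ∀ U : X.Opens, (P : Set X) ⊆ (U : Set X) →
        ∃ s : CentreSeq (U : Scheme.{u}), s.AllRegular ∧ s.CentresOver (U.ι.base ⁻¹' (P : Set X)) ∧ Scheme.IsRegular s.top ∧
          ∃ 𝓛' : List s.top.IdealSheafData,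
            ∀ x' ∈ ((((S.residual.K.comap U.ι).comap s.comp).support : Set s.top)),
              s.comp.base x' ∈ U.ι.base ⁻¹' (P : Set X) → IsEndNear ((S.residual.K.comap U.ι).comap s.comp) 𝓛' x'

/-- [OURS · L1 W5.2] **(M2b-S) ⇒ (M2b) per piece**: the F-60 reduction target for repro-3 in the (β′) architecture. -/
def ContactCureReduction₃ : Prop :=
  CossartJannsenSaito2020EmbeddedSequenceBoundary.{u} → ContactCure₃.{u}

open Classical in
/-- [OURS · L1 W5.2] **CONTACT FORM along a piece, POINTWISE CARRIER** (tri-2 (α′) 20:57:58Z / 20:58:54Z / AMEND 21:08:24Z; tri-1 NO OBJECTION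
20:58:12Z).  Data on an open `U ⊇ P`: the contact SURFACE `Σ` (a closed set; d = 2: `closure((H₁^{st} ∩ H₂^{st}) ∖ B)`), ideal-sheaf entries
`(𝓜_c, Φ_c)` on members meeting `P` with the pure entry `(𝓟, ⊤)`, and a designated CARRIER LIST `𝓥` of global ideal sheaves (hosts, members);
at every `x ∈ P` SOME `V ∈ 𝓥` is a carrier AT `x`: order-1 principal stalk, `V` :: members-through-`x` snc near `x` (= K18 / INV-H pointwise),
NF0/NF1 and the stalk equation `K♭_x = V_x + Σ_c 𝓜_{c,x}·Φ_{c,x}` with THAT `V`, and `Σ = Supp V ∩ ⋃_c Supp Φ_c` near `x`; LEG carrier-free with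
target `P`.  F-60 is called ONCE per piece in the 4-fold (`Z := U`, `X_CJS := (Σ ∩ U)_red`, `B :=` the members; `dim Σ ≤ 2 ⟸` NF0 + K21); the
carrier enters only the pointwise END lift over each `x` (tri-2: `H_V′ = Bl_D H_V` near `x`).  Residual = a point of `P` where no listed carrier has
order 1 = the classifier's (M0)(c′) swallowing claim, not a hypothesis here.  NOT a statement of the manuscript. -/
def HasContactFormOnPw (S : MultiHostState X) (P : Set X) : Prop :=
  ∃ (U : X.Opens) (_ : P ⊆ (U : Set X)) (Sfc : Set X) (hSfc : IsClosed Sfc) (𝓥 : List X.IdealSheafData)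
    (𝓒 : List (List (X.IdealSheafData × ℕ) × X.IdealSheafData)) (𝓟 : List (X.IdealSheafData × ℕ)),
    -- entries: monomials on members meeting `P`; the pure entry; legality of the pure entry at every `x ∈ P`
    (∀ c ∈ 𝓒, ∀ p ∈ c.1, p.1 ∈ S.𝓔 ∧ ((p.1.support : Set X) ∩ P).Nonempty) ∧
    (𝓟, (⊤ : X.IdealSheafData)) ∈ 𝓒 ∧
    (∀ x ∈ P, ∀ T ∈ S.𝓔, x ∈ (T.support : Set X) → stalkIdeal (monomialIdeal 𝓟) x ≤ stalkIdeal T x) ∧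
    -- pointwise carrier from the list `𝓥`
    (∀ x ∈ P, ∃ V ∈ 𝓥, ∃ W : X.Opens, x ∈ (W : Set X) ∧ (W : Set X) ⊆ (U : Set X) ∧
      (∃ v : X.presheaf.stalk x, v ∉ (maximalIdeal (X.presheaf.stalk x)) ^ 2 ∧ stalkIdeal V x = Ideal.span {v}) ∧
      HasSNC ((V :: S.𝓔.filter fun T => decide (x ∈ (T.support : Set X))).map fun F => F.comap W.ι) ∧
      (∀ c ∈ 𝓒, x ∈ (c.2.support : Set X) →
        ¬ stalkIdeal c.2 x ≤ stalkIdeal V x ∧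
        ∀ T ∈ S.𝓔, x ∈ (T.support : Set X) → ¬ stalkIdeal c.2 x ≤ stalkIdeal V x ⊔ stalkIdeal T x) ∧
      stalkIdeal S.residual.K x = stalkIdeal V x ⊔ ⨆ c ∈ 𝓒, stalkIdeal (monomialIdeal c.1) x * stalkIdeal c.2 x ∧
      Sfc ∩ (W : Set X) = (V.support : Set X) ∩ (⋃ c ∈ 𝓒, (c.2.support : Set X)) ∩ (W : Set X)) ∧
    -- LEG, carrier-free: on `U`, Sing Σ ∪ (Σ ∩ B) ⊆ P
    (let 𝒵 : X.IdealSheafData := Scheme.IdealSheafData.vanishingIdeal ⟨Sfc, hSfc⟩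
     let Sing : Set X := 𝒵.subschemeι.base '' (Scheme.regularLocus 𝒵.subscheme)ᶜ
     let B : Set X := ⋃ T ∈ S.𝓔, (T.support : Set X)
     ∀ y ∈ (U : Set X), (y ∈ Sing ∨ (y ∈ Sfc ∧ y ∈ B)) → y ∈ P)

/-- [OURS · L1 W5.2] the uniform-carrier form is the special case `𝓥 = [V]` of the pointwise one (shape only; not proved here). -/
def ContactFormOn_uniform_to_pointwise_shape : Prop :=
  ∀ (X : Scheme.{u}) (S : MultiHostState X) (P : Set X), HasContactFormOn S P → HasContactFormOnPw S P

/-- [OURS · L1 W5.2] **(M2b) CONTACT CURE PER PIECE, pointwise-carrier form** = `ContactCure₃` verbatim over `HasContactFormOnPw` (K21 kept;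
one F-60 call per piece in the 4-fold — (T-e) `exists_contactTower` on `U`, (T-b′) legality, pointwise END lift). -/
def ContactCure₃Pw : Prop :=
  ∀ (X : Scheme.{u}) [IsNoetherian X], Scheme.IsRegular X → Scheme.IsExcellent X → topologicalKrullDim X ≤ 4 →
    ∀ (S : MultiHostState X) (P : TopologicalSpace.Closeds X), (P : Set X) ⊆ (S.residual.K.support : Set X) →
      HasContactFormOnPw S (P : Set X) →
      ∀ U : X.Opens, (P : Set X) ⊆ (U : Set X) →
        ∃ s : CentreSeq (U : Scheme.{u}), s.AllRegular ∧ s.CentresOver (U.ι.base ⁻¹' (P : Set X)) ∧ Scheme.IsRegular s.top ∧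
          ∃ 𝓛' : List s.top.IdealSheafData,
            ∀ x' ∈ ((((S.residual.K.comap U.ι).comap s.comp).support : Set s.top)),
              s.comp.base x' ∈ U.ι.base ⁻¹' (P : Set X) → IsEndNear ((S.residual.K.comap U.ι).comap s.comp) 𝓛' x'

/-- [OURS · L1 W5.2] **(M2b-S) ⇒ (M2b) per piece, pointwise-carrier form** — repro-3's F-60 reduction target of record if lead-1 files the ′ form. -/
def ContactCureReduction₃Pw : Prop :=
  CossartJannsenSaito2020EmbeddedSequenceBoundary.{u} → ContactCure₃Pw.{u}



/-! ## §2 (rev 2, 2026-08-27T21:4xZ) The pointwise-carrier contact form WITH THE CARRIER GUARDS (res-L1-w52-tri-2 OBJECTION 21:30:55Z,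
res-L1-w52-tri-1 CONCUR 21:31:38Z: as typed in §1, `HasContactFormOnPw` is UNSATISFIABLE on a piece holding two carrier kinds — the entry whose
ideal IS the carrier at `x` makes NF0 read `¬ V_x ≤ V_x` and puts `Supp V ∩ Supp V` (3-dimensional) into the set clause; FIX = the two guards
`c.2 ≠ V →` in the NF line and in the union of the set clause, nothing else; with them the Prop is inhabited by the state΄s own summand data
(`𝓥 := hosts`, `𝓒 := all summands`).  The §1 decls stay (tree is append-only); the targets of record are the primed ones below.) -/

open Classical in
/-- [OURS · L1 W5.2] **CONTACT FORM along a piece, POINTWISE CARRIER, rev 2 (carrier guards)** — `HasContactFormOnPw` with, at each `x ∈ P` and its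
chosen carrier `V`, the NF0/NF1 clause and the union in the set clause `Sfc ∩ W = Supp V ∩ ⋃_{c, Φ_c ≠ V} Supp Φ_c ∩ W` ranging over the entries
whose ideal is NOT the carrier `V` (res-L1-w52-tri-2 21:30:55Z / tri-1 21:31:38Z).  NOT a statement of the manuscript. -/
def HasContactFormOnPw' (S : MultiHostState X) (P : Set X) : Prop :=
  ∃ (U : X.Opens) (_ : P ⊆ (U : Set X)) (Sfc : Set X) (hSfc : IsClosed Sfc) (𝓥 : List X.IdealSheafData)
    (𝓒 : List (List (X.IdealSheafData × ℕ) × X.IdealSheafData)) (𝓟 : List (X.IdealSheafData × ℕ)),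
    -- entries: monomials on members meeting `P`; the pure entry; legality of the pure entry at every `x ∈ P`
    (∀ c ∈ 𝓒, ∀ p ∈ c.1, p.1 ∈ S.𝓔 ∧ ((p.1.support : Set X) ∩ P).Nonempty) ∧
    (𝓟, (⊤ : X.IdealSheafData)) ∈ 𝓒 ∧
    (∀ x ∈ P, ∀ T ∈ S.𝓔, x ∈ (T.support : Set X) → stalkIdeal (monomialIdeal 𝓟) x ≤ stalkIdeal T x) ∧
    -- pointwise carrier from the list `𝓥`
    (∀ x ∈ P, ∃ V ∈ 𝓥, ∃ W : X.Opens, x ∈ (W : Set X) ∧ (W : Set X) ⊆ (U : Set X) ∧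
      (∃ v : X.presheaf.stalk x, v ∉ (maximalIdeal (X.presheaf.stalk x)) ^ 2 ∧ stalkIdeal V x = Ideal.span {v}) ∧
      HasSNC ((V :: S.𝓔.filter fun T => decide (x ∈ (T.support : Set X))).map fun F => F.comap W.ι) ∧
      (∀ c ∈ 𝓒, c.2 ≠ V → x ∈ (c.2.support : Set X) →
        ¬ stalkIdeal c.2 x ≤ stalkIdeal V x ∧
        ∀ T ∈ S.𝓔, x ∈ (T.support : Set X) → ¬ stalkIdeal c.2 x ≤ stalkIdeal V x ⊔ stalkIdeal T x) ∧
      stalkIdeal S.residual.K x = stalkIdeal V x ⊔ ⨆ c ∈ 𝓒, stalkIdeal (monomialIdeal c.1) x * stalkIdeal c.2 x ∧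
      Sfc ∩ (W : Set X) = (V.support : Set X) ∩ (⋃ c ∈ 𝓒, ⋃ (_ : c.2 ≠ V), (c.2.support : Set X)) ∩ (W : Set X)) ∧
    -- LEG, carrier-free: on `U`, Sing Σ ∪ (Σ ∩ B) ⊆ P
    (let 𝒵 : X.IdealSheafData := Scheme.IdealSheafData.vanishingIdeal ⟨Sfc, hSfc⟩
     let Sing : Set X := 𝒵.subschemeι.base '' (Scheme.regularLocus 𝒵.subscheme)ᶜ
     let B : Set X := ⋃ T ∈ S.𝓔, (T.support : Set X)
     ∀ y ∈ (U : Set X), (y ∈ Sing ∨ (y ∈ Sfc ∧ y ∈ B)) → y ∈ P)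


/-- [OURS · L1 W5.2] **(M2b) CONTACT CURE PER PIECE, pointwise-carrier form rev 2** = `ContactCure₃Pw` verbatim over `HasContactFormOnPw'`. -/
def ContactCure₃Pw' : Prop :=
  ∀ (X : Scheme.{u}) [IsNoetherian X], Scheme.IsRegular X → Scheme.IsExcellent X → topologicalKrullDim X ≤ 4 →
    ∀ (S : MultiHostState X) (P : TopologicalSpace.Closeds X), (P : Set X) ⊆ (S.residual.K.support : Set X) →
      HasContactFormOnPw' S (P : Set X) →
      ∀ U : X.Opens, (P : Set X) ⊆ (U : Set X) →
        ∃ s : CentreSeq (U : Scheme.{u}), s.AllRegular ∧ s.CentresOver (U.ι.base ⁻¹' (P : Set X)) ∧ Scheme.IsRegular s.top ∧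
          ∃ 𝓛' : List s.top.IdealSheafData,
            ∀ x' ∈ ((((S.residual.K.comap U.ι).comap s.comp).support : Set s.top)),
              s.comp.base x' ∈ U.ι.base ⁻¹' (P : Set X) → IsEndNear ((S.residual.K.comap U.ι).comap s.comp) 𝓛' x'

/-- [OURS · L1 W5.2] **(M2b-S) ⇒ (M2b) per piece, pointwise-carrier form rev 2** — res-D-repro-1΄s F-60 reduction TARGET OF RECORD. -/
def ContactCureReduction₃Pw' : Prop :=
  CossartJannsenSaito2020EmbeddedSequenceBoundary.{u} → ContactCure₃Pw'.{u}


/-! ## §3 (rev 3, 2026-08-27T22:0xZ) The pointwise-carrier contact form WITH STALKWISE PRINCIPAL ENTRIES (typing flag K26, res-L1-w52-lead-1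
21:50:26Z, no objection in the 10-min window): F-60΄s hypothesis «no irreducible component of the contact surface lies in the boundary» follows
from NF1 only when the entry ideals are locally principal along the piece (Krull: then every component of `Supp V ∩ Supp Φ_c` has codimension
`≤ 2` and its generic prime at `x` is `V_x ⊔ T_x`); for an arbitrary ideal-sheaf entry (e.g. the ideal of a curve inside `V ∩ T`) the contact
surface acquires a component inside `B` and the cure is not known to exist.  In the intended witness the entries are hosts (stalkwise principal,
`CylReach.hostsPrincipal`) and the pure entry `⊤`.  The decls of §1/§2 stay (append-only); THE TARGETS OF RECORD ARE THE `₃` DECLS BELOW. -/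

open Classical in
/-- [OURS · L1 W5.2] **CONTACT FORM along a piece, POINTWISE CARRIER, rev 3** = `HasContactFormOnPw'` (carrier guards) + «every entry ideal is stalkwise
principal at every point of `P`».  NOT a statement of the manuscript. -/
def HasContactFormOnPw₃ (S : MultiHostState X) (P : Set X) : Prop :=
  ∃ (U : X.Opens) (_ : P ⊆ (U : Set X)) (Sfc : Set X) (hSfc : IsClosed Sfc) (𝓥 : List X.IdealSheafData)
    (𝓒 : List (List (X.IdealSheafData × ℕ) × X.IdealSheafData)) (𝓟 : List (X.IdealSheafData × ℕ)),
    -- entries: monomials on members meeting `P`; the pure entry; legality of the pure entry at every `x ∈ P`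
    (∀ c ∈ 𝓒, ∀ p ∈ c.1, p.1 ∈ S.𝓔 ∧ ((p.1.support : Set X) ∩ P).Nonempty) ∧
    (𝓟, (⊤ : X.IdealSheafData)) ∈ 𝓒 ∧
    (∀ x ∈ P, ∀ T ∈ S.𝓔, x ∈ (T.support : Set X) → stalkIdeal (monomialIdeal 𝓟) x ≤ stalkIdeal T x) ∧
    -- entries stalkwise PRINCIPAL along `P` (rev 3: needed for F-60΄s «no component in the boundary» via Krull)
    (∀ x ∈ P, ∀ c ∈ 𝓒, ∃ φ : X.presheaf.stalk x, stalkIdeal c.2 x = Ideal.span {φ}) ∧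
    -- pointwise carrier from the list `𝓥`
    (∀ x ∈ P, ∃ V ∈ 𝓥, ∃ W : X.Opens, x ∈ (W : Set X) ∧ (W : Set X) ⊆ (U : Set X) ∧
      (∃ v : X.presheaf.stalk x, v ∉ (maximalIdeal (X.presheaf.stalk x)) ^ 2 ∧ stalkIdeal V x = Ideal.span {v}) ∧
      HasSNC ((V :: S.𝓔.filter fun T => decide (x ∈ (T.support : Set X))).map fun F => F.comap W.ι) ∧
      (∀ c ∈ 𝓒, c.2 ≠ V → x ∈ (c.2.support : Set X) →
        ¬ stalkIdeal c.2 x ≤ stalkIdeal V x ∧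
        ∀ T ∈ S.𝓔, x ∈ (T.support : Set X) → ¬ stalkIdeal c.2 x ≤ stalkIdeal V x ⊔ stalkIdeal T x) ∧
      stalkIdeal S.residual.K x = stalkIdeal V x ⊔ ⨆ c ∈ 𝓒, stalkIdeal (monomialIdeal c.1) x * stalkIdeal c.2 x ∧
      Sfc ∩ (W : Set X) = (V.support : Set X) ∩ (⋃ c ∈ 𝓒, ⋃ (_ : c.2 ≠ V), (c.2.support : Set X)) ∩ (W : Set X)) ∧
    -- LEG, carrier-free: on `U`, Sing Σ ∪ (Σ ∩ B) ⊆ P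
    (let 𝒵 : X.IdealSheafData := Scheme.IdealSheafData.vanishingIdeal ⟨Sfc, hSfc⟩
     let Sing : Set X := 𝒵.subschemeι.base '' (Scheme.regularLocus 𝒵.subscheme)ᶜ
     let B : Set X := ⋃ T ∈ S.𝓔, (T.support : Set X)
     ∀ y ∈ (U : Set X), (y ∈ Sing ∨ (y ∈ Sfc ∧ y ∈ B)) → y ∈ P)



/-- [OURS · L1 W5.2] **(M2b) CONTACT CURE PER PIECE, rev 3** = `ContactCure₃Pw` verbatim over `HasContactFormOnPw₃`. -/
def ContactCure₃Pw₃ : Prop :=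
  ∀ (X : Scheme.{u}) [IsNoetherian X], Scheme.IsRegular X → Scheme.IsExcellent X → topologicalKrullDim X ≤ 4 →
    ∀ (S : MultiHostState X) (P : TopologicalSpace.Closeds X), (P : Set X) ⊆ (S.residual.K.support : Set X) →
      HasContactFormOnPw₃ S (P : Set X) →
      ∀ U : X.Opens, (P : Set X) ⊆ (U : Set X) →
        ∃ s : CentreSeq (U : Scheme.{u}), s.AllRegular ∧ s.CentresOver (U.ι.base ⁻¹' (P : Set X)) ∧ Scheme.IsRegular s.top ∧
          ∃ 𝓛' : List s.top.IdealSheafData,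
            ∀ x' ∈ ((((S.residual.K.comap U.ι).comap s.comp).support : Set s.top)),
              s.comp.base x' ∈ U.ι.base ⁻¹' (P : Set X) → IsEndNear ((S.residual.K.comap U.ι).comap s.comp) 𝓛' x'

/-- [OURS · L1 W5.2] **(M2b-S) ⇒ (M2b) per piece, rev 3** — the F-60 reduction TARGET OF RECORD. -/
def ContactCureReduction₃Pw₃ : Prop :=
  CossartJannsenSaito2020EmbeddedSequenceBoundary.{u} → ContactCure₃Pw₃.{u}


/-! ## §4 (rev 4, 2026-08-27T22:3xZ) CARRIERS ARE NOT MEMBERS.  While writing the cure (…ContactCurePw §1b): if the carrier `V` at `x` were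
a member (`V ∈ S.𝓔`), the set clause puts `Sfc ∩ W ⊆ Supp V ⊆ B`, every component of the contact surface lies in the boundary and F-60΄s
hypothesis «no component inside `B`» is void — the cure is then not known to exist; nothing in rev 3 excluded it (a repeated ideal in the snc
list is tolerated by `HasSNC`).  In the intended witness carriers are HOSTS.  rev 4 = rev 3 + the guard `V ∉ S.𝓔`; TARGETS OF RECORD = `₄`. -/

open Classical in
/-- [OURS · L1 W5.2] **CONTACT FORM along a piece, POINTWISE CARRIER, rev 4** = rev 3 + «the carrier at `x` is not a member».  NOT a statement
of the manuscript. -/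
def HasContactFormOnPw₄ (S : MultiHostState X) (P : Set X) : Prop :=
  ∃ (U : X.Opens) (_ : P ⊆ (U : Set X)) (Sfc : Set X) (hSfc : IsClosed Sfc) (𝓥 : List X.IdealSheafData)
    (𝓒 : List (List (X.IdealSheafData × ℕ) × X.IdealSheafData)) (𝓟 : List (X.IdealSheafData × ℕ)),
    -- entries: monomials on members meeting `P`; the pure entry; legality of the pure entry at every `x ∈ P`
    (∀ c ∈ 𝓒, ∀ p ∈ c.1, p.1 ∈ S.𝓔 ∧ ((p.1.support : Set X) ∩ P).Nonempty) ∧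
    (𝓟, (⊤ : X.IdealSheafData)) ∈ 𝓒 ∧
    (∀ x ∈ P, ∀ T ∈ S.𝓔, x ∈ (T.support : Set X) → stalkIdeal (monomialIdeal 𝓟) x ≤ stalkIdeal T x) ∧
    -- entries stalkwise PRINCIPAL along `P` (rev 3: needed for F-60΄s «no component in the boundary» via Krull)
    (∀ x ∈ P, ∀ c ∈ 𝓒, ∃ φ : X.presheaf.stalk x, stalkIdeal c.2 x = Ideal.span {φ}) ∧
    -- pointwise carrier from the list `𝓥`, NOT A MEMBER (rev 4: else the contact surface lies in the boundary and F-60 is void)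
    (∀ x ∈ P, ∃ V ∈ 𝓥, V ∉ S.𝓔 ∧ ∃ W : X.Opens, x ∈ (W : Set X) ∧ (W : Set X) ⊆ (U : Set X) ∧
      (∃ v : X.presheaf.stalk x, v ∉ (maximalIdeal (X.presheaf.stalk x)) ^ 2 ∧ stalkIdeal V x = Ideal.span {v}) ∧
      HasSNC ((V :: S.𝓔.filter fun T => decide (x ∈ (T.support : Set X))).map fun F => F.comap W.ι) ∧
      (∀ c ∈ 𝓒, c.2 ≠ V → x ∈ (c.2.support : Set X) →
        ¬ stalkIdeal c.2 x ≤ stalkIdeal V x ∧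
        ∀ T ∈ S.𝓔, x ∈ (T.support : Set X) → ¬ stalkIdeal c.2 x ≤ stalkIdeal V x ⊔ stalkIdeal T x) ∧
      stalkIdeal S.residual.K x = stalkIdeal V x ⊔ ⨆ c ∈ 𝓒, stalkIdeal (monomialIdeal c.1) x * stalkIdeal c.2 x ∧
      Sfc ∩ (W : Set X) = (V.support : Set X) ∩ (⋃ c ∈ 𝓒, ⋃ (_ : c.2 ≠ V), (c.2.support : Set X)) ∩ (W : Set X)) ∧
    -- LEG, carrier-free: on `U`, Sing Σ ∪ (Σ ∩ B) ⊆ P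
    (let 𝒵 : X.IdealSheafData := Scheme.IdealSheafData.vanishingIdeal ⟨Sfc, hSfc⟩
     let Sing : Set X := 𝒵.subschemeι.base '' (Scheme.regularLocus 𝒵.subscheme)ᶜ
     let B : Set X := ⋃ T ∈ S.𝓔, (T.support : Set X)
     ∀ y ∈ (U : Set X), (y ∈ Sing ∨ (y ∈ Sfc ∧ y ∈ B)) → y ∈ P)




/-- [OURS · L1 W5.2] **(M2b) CONTACT CURE PER PIECE, rev 4** = `ContactCure₃Pw` verbatim over `HasContactFormOnPw₄`. -/
def ContactCure₃Pw₄ : Prop :=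
  ∀ (X : Scheme.{u}) [IsNoetherian X], Scheme.IsRegular X → Scheme.IsExcellent X → topologicalKrullDim X ≤ 4 →
    ∀ (S : MultiHostState X) (P : TopologicalSpace.Closeds X), (P : Set X) ⊆ (S.residual.K.support : Set X) →
      HasContactFormOnPw₄ S (P : Set X) →
      ∀ U : X.Opens, (P : Set X) ⊆ (U : Set X) →
        ∃ s : CentreSeq (U : Scheme.{u}), s.AllRegular ∧ s.CentresOver (U.ι.base ⁻¹' (P : Set X)) ∧ Scheme.IsRegular s.top ∧
          ∃ 𝓛' : List s.top.IdealSheafData,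
            ∀ x' ∈ ((((S.residual.K.comap U.ι).comap s.comp).support : Set s.top)),
              s.comp.base x' ∈ U.ι.base ⁻¹' (P : Set X) → IsEndNear ((S.residual.K.comap U.ι).comap s.comp) 𝓛' x'

/-- [OURS · L1 W5.2] **(M2b-S) ⇒ (M2b) per piece, rev 4** — the F-60 reduction TARGET OF RECORD. -/
def ContactCureReduction₃Pw₄ : Prop :=
  CossartJannsenSaito2020EmbeddedSequenceBoundary.{u} → ContactCure₃Pw₄.{u}


/-! ## §5 (rev 5, 2026-08-27T22:4xZ) THE CARRIER DIFFERS FROM EVERY MEMBER AT THE STALK.  rev 4΄s guard `V ∉ S.𝓔` is too weak: if the carrier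
merely agrees with a member at the stalk (`stalkIdeal V x = stalkIdeal T x`), then `Supp V = Supp T` near `x`, the contact surface lies in the
boundary near `x` and F-60 is void there.  rev 5 = rev 4 + «`∀ T ∈ S.𝓔, x ∈ Supp T → stalkIdeal V x ≠ stalkIdeal T x`» — exactly what the cure΄s
«no component in the boundary» argument consumes (two DISTINCT members of the regular system at the generic point).  TARGETS OF RECORD = `₅`. -/

open Classical in
/-- [OURS · L1 W5.2] **CONTACT FORM along a piece, POINTWISE CARRIER, rev 5** = rev 4 + «the carrier differs from every member through `x` at the
stalk».  NOT a statement of the manuscript. -/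
def HasContactFormOnPw₅ (S : MultiHostState X) (P : Set X) : Prop :=
  ∃ (U : X.Opens) (_ : P ⊆ (U : Set X)) (Sfc : Set X) (hSfc : IsClosed Sfc) (𝓥 : List X.IdealSheafData)
    (𝓒 : List (List (X.IdealSheafData × ℕ) × X.IdealSheafData)) (𝓟 : List (X.IdealSheafData × ℕ)),
    -- entries: monomials on members meeting `P`; the pure entry; legality of the pure entry at every `x ∈ P`
    (∀ c ∈ 𝓒, ∀ p ∈ c.1, p.1 ∈ S.𝓔 ∧ ((p.1.support : Set X) ∩ P).Nonempty) ∧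
    (𝓟, (⊤ : X.IdealSheafData)) ∈ 𝓒 ∧
    (∀ x ∈ P, ∀ T ∈ S.𝓔, x ∈ (T.support : Set X) → stalkIdeal (monomialIdeal 𝓟) x ≤ stalkIdeal T x) ∧
    -- entries stalkwise PRINCIPAL along `P` (rev 3: needed for F-60΄s «no component in the boundary» via Krull)
    (∀ x ∈ P, ∀ c ∈ 𝓒, ∃ φ : X.presheaf.stalk x, stalkIdeal c.2 x = Ideal.span {φ}) ∧
    -- pointwise carrier from the list `𝓥`, NOT A MEMBER, NOT EVEN AT THE STALK (rev 4/5: else the contact surface lies in the boundary near `x`)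
    (∀ x ∈ P, ∃ V ∈ 𝓥, V ∉ S.𝓔 ∧ (∀ T ∈ S.𝓔, x ∈ (T.support : Set X) → stalkIdeal V x ≠ stalkIdeal T x) ∧
      ∃ W : X.Opens, x ∈ (W : Set X) ∧ (W : Set X) ⊆ (U : Set X) ∧
      (∃ v : X.presheaf.stalk x, v ∉ (maximalIdeal (X.presheaf.stalk x)) ^ 2 ∧ stalkIdeal V x = Ideal.span {v}) ∧
      HasSNC ((V :: S.𝓔.filter fun T => decide (x ∈ (T.support : Set X))).map fun F => F.comap W.ι) ∧
      (∀ c ∈ 𝓒, c.2 ≠ V → x ∈ (c.2.support : Set X) →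
        ¬ stalkIdeal c.2 x ≤ stalkIdeal V x ∧
        ∀ T ∈ S.𝓔, x ∈ (T.support : Set X) → ¬ stalkIdeal c.2 x ≤ stalkIdeal V x ⊔ stalkIdeal T x) ∧
      stalkIdeal S.residual.K x = stalkIdeal V x ⊔ ⨆ c ∈ 𝓒, stalkIdeal (monomialIdeal c.1) x * stalkIdeal c.2 x ∧
      Sfc ∩ (W : Set X) = (V.support : Set X) ∩ (⋃ c ∈ 𝓒, ⋃ (_ : c.2 ≠ V), (c.2.support : Set X)) ∩ (W : Set X)) ∧
    -- LEG, carrier-free: on `U`, Sing Σ ∪ (Σ ∩ B) ⊆ P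
    (let 𝒵 : X.IdealSheafData := Scheme.IdealSheafData.vanishingIdeal ⟨Sfc, hSfc⟩
     let Sing : Set X := 𝒵.subschemeι.base '' (Scheme.regularLocus 𝒵.subscheme)ᶜ
     let B : Set X := ⋃ T ∈ S.𝓔, (T.support : Set X)
     ∀ y ∈ (U : Set X), (y ∈ Sing ∨ (y ∈ Sfc ∧ y ∈ B)) → y ∈ P)





/-- [OURS · L1 W5.2] **(M2b) CONTACT CURE PER PIECE, rev 5** = `ContactCure₃Pw` verbatim over `HasContactFormOnPw₅`. -/
def ContactCure₃Pw₅ : Prop :=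
  ∀ (X : Scheme.{u}) [IsNoetherian X], Scheme.IsRegular X → Scheme.IsExcellent X → topologicalKrullDim X ≤ 4 →
    ∀ (S : MultiHostState X) (P : TopologicalSpace.Closeds X), (P : Set X) ⊆ (S.residual.K.support : Set X) →
      HasContactFormOnPw₅ S (P : Set X) →
      ∀ U : X.Opens, (P : Set X) ⊆ (U : Set X) →
        ∃ s : CentreSeq (U : Scheme.{u}), s.AllRegular ∧ s.CentresOver (U.ι.base ⁻¹' (P : Set X)) ∧ Scheme.IsRegular s.top ∧
          ∃ 𝓛' : List s.top.IdealSheafData,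
            ∀ x' ∈ ((((S.residual.K.comap U.ι).comap s.comp).support : Set s.top)),
              s.comp.base x' ∈ U.ι.base ⁻¹' (P : Set X) → IsEndNear ((S.residual.K.comap U.ι).comap s.comp) 𝓛' x'

/-- [OURS · L1 W5.2] **(M2b-S) ⇒ (M2b) per piece, rev 5** — the F-60 reduction TARGET OF RECORD. -/
def ContactCureReduction₃Pw₅ : Prop :=
  CossartJannsenSaito2020EmbeddedSequenceBoundary.{u} → ContactCure₃Pw₅.{u}

end Summit.ResolutionOfSingularities.ResolutionOfSingularities.Theorems.X3LemmaM

end
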